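import Summits.QuantumFields.GaugeBoot.BootstrapConvergence
import Summits.QuantumFields.GaugeBoot.OrderUnitDuality
import HarnessLib

/-!
# Bootstrap certificates: the cone of sums of squares plus Schwinger–Dyson rows, and its soundness (gauge-boot, L1/L4 supplement)

HONEST FRAMING (cell `pub-gaugeboot`, page 1 of every file): the venture produces certified bounds
on lattice expectations at stated coupling, gauge group, dimension and torus size; NOT a mass gap,
NOT a continuum limit, NOT a string tension; NOT Yang–Mills-summit-bearing (barriers
`FixedCouplingUltralocality`, `PerturbativeInvisibility`). Structural; it certifies no number.

## Content (what a dual SDP certificate of the lattice bootstrap IS, as an algebraic object)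

The truncated bootstrap with test-function set `V` (`IsBootstrapFeasible r k S β V φ`:
`φ 1 = 1`, `0 ≤ φ (v v)` for `v ∈ V`, the loop equations `φ f' = β φ (f S_i')` for `f ∈ V`) is the
set of normalised linear functionals non-negative on a CONE of observables:

* `sosCone V` — non-negative combinations of squares `v v`, `v ∈ V`;
* `rowSet r k S β V` / `rowSpace` — the ROW ELEMENTS `f' - β • (f S_i')` (`f ∈ V`, `f'`, `S_i'` the
  polynomial one-link shift derivatives of `f` and of the local action `S i` along `k a`) and
  their linear span;
* `certCone r k S β V = sosCone V + rowSpace` — the CERTIFICATE CONE. An identity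
  `c • 1 - P = Σ_j v_j v_j + Σ_l λ_l (f_l' - β f_l S_l')` is exactly a dual certificate of the
  level-`V` SDP for the bound `P ≤ c` (the form the cell's `certsdp` certificates take).

Theorems:
* `IsBootstrapFeasible.nonneg_of_mem_certCone` — a feasible functional is non-negative on the
  certificate cone (squares by positivity, rows by the loop equations and uniqueness of derivatives);
  ★ `isBootstrapFeasible_iff_isDualFeasible` — feasibility IS dual feasibility for `(certCone, 1)`
  in the sense of `OrderUnitDuality` (given that the local actions have polynomial derivatives);
* ★★ `IsBootstrapFeasible.apply_le_of_mem_certCone` / `le_apply_of_mem_certCone` — SOUNDNESS: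
  `c • 1 - P ∈ certCone` forces `φ P ≤ c` for every feasible `φ`, `P - c • 1 ∈ certCone` forces
  `c ≤ φ P`; `integral_le_of_mem_certCone` — in particular for the expectation of every polynomial
  Schwinger–Dyson probability state (Wilson's measure on a torus, DLR states on `ℤ^d`);
* `certCone_mono` — larger test sets, larger certificate cones.

Completeness (every valid bound has such a certificate) is `BootstrapCertificateCompleteness.lean`.

References: P. Anderson, M. Kruczenski, Nucl. Phys. B 921 (2017) §2; V. Kazakov, Z. Zheng,
arXiv:2203.11360 §2, arXiv:2404.16925 §3 (the primal/dual SDPs); C. Josz, D. Henrion, Optim. Lett.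
10 (2016) 3. Folklore.
-/

noncomputable section

open MeasureTheory NormedSpace
open Literature.MathematicalPhysics.QuantumFieldTheory (LatticeRep)

namespace Summit.QuantumFields.GaugeBoot

open OrderUnitDuality

/-! ## The cones -/

section SOS

variable {ι : Type*} {G : Type*} [TopologicalSpace G]

/-- **The cone of sums of squares of test functions**: non-negative combinations of `v v`,
`v ∈ V`. [folklore] -/
def sosCone (V : Set C(ι → G, ℝ)) : PointedCone ℝ C(ι → G, ℝ) :=
  Submodule.span {c : ℝ // 0 ≤ c} {x | ∃ v ∈ V, v * v = x}

/-- Squares of test functions lie in the SOS cone. -/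
theorem mul_self_mem_sosCone {V : Set C(ι → G, ℝ)} {v : C(ι → G, ℝ)} (hv : v ∈ V) :
    v * v ∈ sosCone V :=
  Submodule.subset_span ⟨v, hv, rfl⟩

/-- The SOS cone is monotone in the test set. -/
theorem sosCone_mono {V W : Set C(ι → G, ℝ)} (hVW : V ⊆ W) : sosCone V ≤ sosCone W :=
  Submodule.span_mono fun _ ⟨v, hv, hx⟩ => ⟨v, hVW hv, hx⟩

/-- A functional non-negative on the squares of `V` is non-negative on the SOS cone. -/
theorem nonneg_of_mem_sosCone {V : Set C(ι → G, ℝ)} {φ : C(ι → G, ℝ) →ₗ[ℝ] ℝ}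
    (hφ : ∀ v ∈ V, 0 ≤ φ (v * v)) {x : C(ι → G, ℝ)} (hx : x ∈ sosCone V) : 0 ≤ φ x := by
  induction hx using Submodule.span_induction with
  | mem x hx =>
    obtain ⟨v, hv, rfl⟩ := hx
    exact hφ v hv
  | zero => rw [map_zero]
  | add x y _ _ hx hy => rw [map_add]; exact add_nonneg hx hy
  | smul c x _ hx =>
    have h : φ (c • x) = (c : ℝ) * φ x := by
      rw [show c • x = (c : ℝ) • x from rfl, map_smul, smul_eq_mul]
    rw [h]
    exact mul_nonneg c.2 hx

end SOS

section Rows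

variable {ι : Type*} [DecidableEq ι] {G : Type*} [Group G] [TopologicalSpace G] (r : LatticeRep G)
  {K : Type*}

/-- **The row elements** of the truncated loop equations: `f' - β • (f S')` for a test function
`f ∈ V`, a link `i`, a direction `a`, with `f'`, `S'` THE polynomial derivatives of `f` and of the
local action `S i` along the one-link shift `U ↦ U[i ↦ k a (t) U_i]`. [folklore] -/
def rowSet (k : K → ℝ → G) (S : ι → (ι → G) → ℝ) (β : ℝ) (V : Set C(ι → G, ℝ)) :
    Set C(ι → G, ℝ) :=
  {x | ∃ (i : ι) (a : K) (f f' S' : C(ι → G, ℝ)), f ∈ V ∧ f' ∈ polyAlgebra (ι := ι) r ∧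
    S' ∈ polyAlgebra (ι := ι) r ∧
    (∀ U, HasDerivAt (fun t => S i (Function.update U i (k a t * U i))) (S' U) 0) ∧
    (∀ U, HasDerivAt (fun t => f (Function.update U i (k a t * U i))) (f' U) 0) ∧
    f' - β • (f * S') = x}

/-- **The row space**: the linear span of the row elements. [folklore] -/
def rowSpace (k : K → ℝ → G) (S : ι → (ι → G) → ℝ) (β : ℝ) (V : Set C(ι → G, ℝ)) :
    Submodule ℝ C(ι → G, ℝ) :=
  Submodule.span ℝ (rowSet r k S β V)

/-- **The certificate cone** of the truncated bootstrap with test set `V`: sums of squares of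
test functions plus linear combinations of row elements. An identity `c • 1 - P ∈ certCone` is a
dual certificate for `P ≤ c`. [folklore] -/
def certCone (k : K → ℝ → G) (S : ι → (ι → G) → ℝ) (β : ℝ) (V : Set C(ι → G, ℝ)) :
    PointedCone ℝ C(ι → G, ℝ) :=
  sosCone V ⊔ (rowSpace r k S β V).restrictScalars {c : ℝ // 0 ≤ c}

variable {k : K → ℝ → G} {X : K → Matrix (Fin r.N) (Fin r.N) ℂ} {S : ι → (ι → G) → ℝ} {β : ℝ}

/-- Membership in the certificate cone, unpacked: an SOS part plus a row combination. -/
theorem mem_certCone_iff {V : Set C(ι → G, ℝ)} {x : C(ι → G, ℝ)} :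
    x ∈ certCone r k S β V ↔ ∃ σ ∈ sosCone V, ∃ ρ ∈ rowSpace r k S β V, σ + ρ = x := by
  rw [certCone, Submodule.mem_sup]
  simp only [Submodule.restrictScalars_mem]

/-- The SOS cone sits inside the certificate cone. -/
theorem sosCone_le_certCone {V : Set C(ι → G, ℝ)} : sosCone V ≤ certCone r k S β V :=
  le_sup_left

/-- The row space sits inside the certificate cone. -/
theorem mem_certCone_of_mem_rowSpace {V : Set C(ι → G, ℝ)} {x : C(ι → G, ℝ)}
    (hx : x ∈ rowSpace r k S β V) : x ∈ certCone r k S β V :=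
  Submodule.mem_sup_right hx

/-- Row elements sit inside the certificate cone. -/
theorem mem_certCone_of_mem_rowSet {V : Set C(ι → G, ℝ)} {x : C(ι → G, ℝ)}
    (hx : x ∈ rowSet r k S β V) : x ∈ certCone r k S β V :=
  mem_certCone_of_mem_rowSpace r (Submodule.subset_span hx)

/-- `1 = 1 · 1` is in the certificate cone as soon as `1` is a test function. -/
theorem one_mem_certCone {V : Set C(ι → G, ℝ)} (h1 : (1 : C(ι → G, ℝ)) ∈ V) :
    (1 : C(ι → G, ℝ)) ∈ certCone r k S β V := by
  have h := sosCone_le_certCone r (k := k) (S := S) (β := β) (mul_self_mem_sosCone h1)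
  rwa [mul_one] at h

/-- **The certificate cone is monotone in the test set.** -/
theorem certCone_mono {V W : Set C(ι → G, ℝ)} (hVW : V ⊆ W) :
    certCone r k S β V ≤ certCone r k S β W := by
  refine sup_le_sup (sosCone_mono hVW) ?_
  intro x hx
  rw [Submodule.restrictScalars_mem] at hx ⊢
  refine Submodule.span_mono (fun y hy => ?_) hx
  obtain ⟨i, a, f, f', S', hf, hf', hS', hS'd, hf'd, rfl⟩ := hy
  exact ⟨i, a, f, f', S', hVW hf, hf', hS', hS'd, hf'd, rfl⟩

/-- **Polynomial local actions have polynomial derivatives** along every exponential shift: the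
hypothesis `hS` of `isBootstrapFeasible_iff_isDualFeasible` in the standard setting. -/
theorem exists_polyDeriv_of_mem_polyFunctions [ContinuousMul G]
    (hk : ∀ a s t, k a (s + t) = k a s * k a t)
    (hX : ∀ a t, r.ρ (k a t) = exp ((t : ℂ) • X a)) (hS : ∀ i, S i ∈ polyFunctions (ι := ι) r)
    (i : ι) (a : K) :
    ∃ S' ∈ polyAlgebra (ι := ι) r,
      ∀ U, HasDerivAt (fun t => S i (Function.update U i (k a t * U i))) (S' U) 0 := by
  obtain ⟨S₀, hS₀, hS₀e⟩ := (mem_polyFunctions_iff r).1 (hS i)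
  obtain ⟨S', hS'm, hS'⟩ := exists_deriv_mem_polyAlgebra r (hk a) (hX a) i hS₀
  refine ⟨S', hS'm, fun U => ?_⟩
  rw [← hS₀e]
  exact hS' U

end Rows

/-! ## Feasible functionals and the certificate cone -/

section General

variable {ι : Type*} [DecidableEq ι] [Countable ι] {G : Type*} [Group G] [TopologicalSpace G]
  [IsTopologicalGroup G] [CompactSpace G] [MeasurableSpace G] [BorelSpace G]
  [SecondCountableTopology G] (r : LatticeRep G) {K : Type*}
  {k : K → ℝ → G} {X : K → Matrix (Fin r.N) (Fin r.N) ℂ} {S : ι → (ι → G) → ℝ} {β : ℝ}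

omit [Countable ι] [IsTopologicalGroup G] [CompactSpace G] [MeasurableSpace G] [BorelSpace G]
  [SecondCountableTopology G] in
/-- **A feasible functional annihilates every row element** (its loop equation, with the
derivative of the action identified by uniqueness of derivatives). -/
theorem IsBootstrapFeasible.apply_eq_zero_of_mem_rowSet {V : Set C(ι → G, ℝ)}
    {φ : C(ι → G, ℝ) →ₗ[ℝ] ℝ} (hφ : IsBootstrapFeasible r k S β V φ) {x : C(ι → G, ℝ)}
    (hx : x ∈ rowSet r k S β V) : φ x = 0 := by
  obtain ⟨i, a, f, f', S', hf, hf', -, hS'd, hf'd, rfl⟩ := hx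
  obtain ⟨S₀, -, hS₀d, hrows⟩ := hφ.2.2 i a
  have he : S' = S₀ := ContinuousMap.ext fun U => (hS'd U).unique (hS₀d U)
  rw [map_sub, map_smul, hrows f hf f' hf' hf'd, he, smul_eq_mul, sub_self]

omit [Countable ι] [IsTopologicalGroup G] [CompactSpace G] [MeasurableSpace G] [BorelSpace G]
  [SecondCountableTopology G] in
/-- A feasible functional annihilates the row space. -/
theorem IsBootstrapFeasible.apply_eq_zero_of_mem_rowSpace {V : Set C(ι → G, ℝ)}
    {φ : C(ι → G, ℝ) →ₗ[ℝ] ℝ} (hφ : IsBootstrapFeasible r k S β V φ) {x : C(ι → G, ℝ)}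
    (hx : x ∈ rowSpace r k S β V) : φ x = 0 := by
  induction hx using Submodule.span_induction with
  | mem x hx => exact hφ.apply_eq_zero_of_mem_rowSet r hx
  | zero => rw [map_zero]
  | add x y _ _ hx hy => rw [map_add, hx, hy, add_zero]
  | smul c x _ hx => rw [map_smul, hx, smul_zero]

omit [Countable ι] [IsTopologicalGroup G] [CompactSpace G] [MeasurableSpace G] [BorelSpace G]
  [SecondCountableTopology G] in
/-- ★ **A feasible functional is non-negative on the certificate cone.** [folklore] -/
theorem IsBootstrapFeasible.nonneg_of_mem_certCone {V : Set C(ι → G, ℝ)}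
    {φ : C(ι → G, ℝ) →ₗ[ℝ] ℝ} (hφ : IsBootstrapFeasible r k S β V φ) {x : C(ι → G, ℝ)}
    (hx : x ∈ certCone r k S β V) : 0 ≤ φ x := by
  obtain ⟨σ, hσ, ρ, hρ, rfl⟩ := (mem_certCone_iff r).1 hx
  rw [map_add, hφ.apply_eq_zero_of_mem_rowSpace r hρ, add_zero]
  exact nonneg_of_mem_sosCone hφ.2.1 hσ

omit [Countable ι] [IsTopologicalGroup G] [CompactSpace G] [MeasurableSpace G] [BorelSpace G]
  [SecondCountableTopology G] in
/-- ★ **Feasible ⇒ dual feasible** for the certificate cone with order unit `1`. [folklore] -/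
theorem IsBootstrapFeasible.isDualFeasible {V : Set C(ι → G, ℝ)} {φ : C(ι → G, ℝ) →ₗ[ℝ] ℝ}
    (hφ : IsBootstrapFeasible r k S β V φ) : IsDualFeasible (certCone r k S β V) 1 φ :=
  ⟨fun _ hx => hφ.nonneg_of_mem_certCone r hx, hφ.1⟩

omit [Countable ι] [IsTopologicalGroup G] [CompactSpace G] [MeasurableSpace G] [BorelSpace G]
  [SecondCountableTopology G] in
/-- ★ **Dual feasible ⇒ feasible**, provided every local action has a polynomial derivative along
every shift (then the loop equation of `f ∈ V` is `φ ≥ 0` on `±` a row element). [folklore] -/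
theorem isBootstrapFeasible_of_isDualFeasible {V : Set C(ι → G, ℝ)}
    (hS : ∀ (i : ι) (a : K), ∃ S' ∈ polyAlgebra (ι := ι) r,
      ∀ U, HasDerivAt (fun t => S i (Function.update U i (k a t * U i))) (S' U) 0)
    {φ : C(ι → G, ℝ) →ₗ[ℝ] ℝ} (hφ : IsDualFeasible (certCone r k S β V) 1 φ) :
    IsBootstrapFeasible r k S β V φ := by
  refine ⟨hφ.2, fun v hv => hφ.1 _ (sosCone_le_certCone r (mul_self_mem_sosCone hv)), fun i a => ?_⟩
  obtain ⟨S', hS'm, hS'd⟩ := hS i a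
  refine ⟨S', hS'm, hS'd, fun f hf f' hf' hf'd => ?_⟩
  have hx : f' - β • (f * S') ∈ rowSet r k S β V := ⟨i, a, f, f', S', hf, hf', hS'm, hS'd, hf'd, rfl⟩
  have h1 : 0 ≤ φ (f' - β • (f * S')) := hφ.1 _ (mem_certCone_of_mem_rowSet r hx)
  have h2 : 0 ≤ φ (-(f' - β • (f * S'))) :=
    hφ.1 _ (mem_certCone_of_mem_rowSpace r ((rowSpace r k S β V).neg_mem (Submodule.subset_span hx)))
  rw [map_neg] at h2
  have h3 : φ (f' - β • (f * S')) = 0 := le_antisymm (by linarith) h1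
  rw [map_sub, map_smul, smul_eq_mul, sub_eq_zero] at h3
  exact h3

omit [Countable ι] [IsTopologicalGroup G] [CompactSpace G] [MeasurableSpace G] [BorelSpace G]
  [SecondCountableTopology G] in
/-- ★ **Bootstrap feasibility is dual feasibility for the certificate cone** (local actions with
polynomial derivatives): the truncated lattice bootstrap is the "moment side" of the conic duality
whose "SOS side" is `certCone`. [folklore] -/
theorem isBootstrapFeasible_iff_isDualFeasible {V : Set C(ι → G, ℝ)}
    (hS : ∀ (i : ι) (a : K), ∃ S' ∈ polyAlgebra (ι := ι) r,
      ∀ U, HasDerivAt (fun t => S i (Function.update U i (k a t * U i))) (S' U) 0)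
    {φ : C(ι → G, ℝ) →ₗ[ℝ] ℝ} :
    IsBootstrapFeasible r k S β V φ ↔ IsDualFeasible (certCone r k S β V) 1 φ :=
  ⟨fun h => h.isDualFeasible r, isBootstrapFeasible_of_isDualFeasible r hS⟩

/-! ## Soundness: certificates bound every feasible value -/

omit [Countable ι] [IsTopologicalGroup G] [CompactSpace G] [MeasurableSpace G] [BorelSpace G]
  [SecondCountableTopology G] in
/-- ★★ **Soundness of upper-bound certificates**: `c • 1 - P ∈ certCone` gives `φ P ≤ c` for every
feasible `φ`. [folklore] -/
theorem IsBootstrapFeasible.apply_le_of_mem_certCone {V : Set C(ι → G, ℝ)}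
    {φ : C(ι → G, ℝ) →ₗ[ℝ] ℝ} (hφ : IsBootstrapFeasible r k S β V φ) {P : C(ι → G, ℝ)} {c : ℝ}
    (hc : c • (1 : C(ι → G, ℝ)) - P ∈ certCone r k S β V) : φ P ≤ c :=
  (hφ.isDualFeasible r).le_of_mem_certLevels hc

omit [Countable ι] [IsTopologicalGroup G] [CompactSpace G] [MeasurableSpace G] [BorelSpace G]
  [SecondCountableTopology G] in
/-- ★★ **Soundness of lower-bound certificates**: `P - c • 1 ∈ certCone` gives `c ≤ φ P`.
[folklore] -/
theorem IsBootstrapFeasible.le_apply_of_mem_certCone {V : Set C(ι → G, ℝ)}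
    {φ : C(ι → G, ℝ) →ₗ[ℝ] ℝ} (hφ : IsBootstrapFeasible r k S β V φ) {P : C(ι → G, ℝ)} {c : ℝ}
    (hc : P - c • (1 : C(ι → G, ℝ)) ∈ certCone r k S β V) : c ≤ φ P :=
  (hφ.isDualFeasible r).le_apply_of_sub_smul_mem hc

omit [Countable ι] [IsTopologicalGroup G] [CompactSpace G] [MeasurableSpace G] [BorelSpace G]
  [SecondCountableTopology G] in
/-- **Two-sided certificates give a certified window.** [folklore] -/
theorem IsBootstrapFeasible.mem_Icc_of_mem_certCone {V : Set C(ι → G, ℝ)}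
    {φ : C(ι → G, ℝ) →ₗ[ℝ] ℝ} (hφ : IsBootstrapFeasible r k S β V φ) {P : C(ι → G, ℝ)} {a b : ℝ}
    (ha : P - a • (1 : C(ι → G, ℝ)) ∈ certCone r k S β V)
    (hb : b • (1 : C(ι → G, ℝ)) - P ∈ certCone r k S β V) : φ P ∈ Set.Icc a b :=
  ⟨hφ.le_apply_of_mem_certCone r ha, hφ.apply_le_of_mem_certCone r hb⟩

/-- ★★ **Certificates bound the expectations of every polynomial Schwinger–Dyson probability
state** (Wilson's measure on a torus; DLR states on `ℤ^d`): a level-`V` certificate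
`c • 1 - P ∈ certCone` with polynomial test functions gives `∫ P dμ ≤ c`. [folklore] -/
theorem integral_le_of_mem_certCone (hk : ∀ a s t, k a (s + t) = k a s * k a t)
    (hX : ∀ a t, r.ρ (k a t) = exp ((t : ℂ) • X a)) (hS : ∀ i, S i ∈ polyFunctions (ι := ι) r)
    (μ : Measure (ι → G)) [IsProbabilityMeasure μ] (hμ : IsPolySchwingerDysonState r k S β μ)
    {V : Set C(ι → G, ℝ)} (hV : V ⊆ polyAlgebra (ι := ι) r) {P : C(ι → G, ℝ)} {c : ℝ}
    (hc : c • (1 : C(ι → G, ℝ)) - P ∈ certCone r k S β V) : ∫ U, P U ∂μ ≤ c := by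
  have h := (isBootstrapFeasible_expectationFunctional r hk hX hS μ hμ hV).apply_le_of_mem_certCone
    r hc
  rwa [expectationFunctional_apply] at h

/-- **Lower-bound certificates bound expectations from below.** [folklore] -/
theorem le_integral_of_mem_certCone (hk : ∀ a s t, k a (s + t) = k a s * k a t)
    (hX : ∀ a t, r.ρ (k a t) = exp ((t : ℂ) • X a)) (hS : ∀ i, S i ∈ polyFunctions (ι := ι) r)
    (μ : Measure (ι → G)) [IsProbabilityMeasure μ] (hμ : IsPolySchwingerDysonState r k S β μ)
    {V : Set C(ι → G, ℝ)} (hV : V ⊆ polyAlgebra (ι := ι) r) {P : C(ι → G, ℝ)} {c : ℝ}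
    (hc : P - c • (1 : C(ι → G, ℝ)) ∈ certCone r k S β V) : c ≤ ∫ U, P U ∂μ := by
  have h := (isBootstrapFeasible_expectationFunctional r hk hX hS μ hμ hV).le_apply_of_mem_certCone
    r hc
  rwa [expectationFunctional_apply] at h

end General

end Summit.QuantumFields.GaugeBoot

end
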